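import Summits.QuantumAdvantage.QuantumAdvantage.Theorems.NearExactIsExact.Negative.FibreL1Bound
import Summits.QuantumAdvantage.QuantumAdvantage.Theorems.CubicForrelationNearExactIsExactRmWeight
import Summits.QuantumAdvantage.QuantumAdvantage.Theorems.CubicForrelationNearExactIsExactDerivDegree

/-!
# `NearExactIsExact` (stmt-QuantumAdvantage-14043), negative side — the SHAPE LEMMA for relabeled fibre families

B2b disprover cell, generation 30 (`b2b-cforr-disprove-g30`).  HONEST FRAMING: a kernel-checked STRUCTURE LEMMA
([folklore] ingredients: fibrewise Walsh calculus, the Reed–Muller distance `d(RM(2,n)) = 2^{n-2}`); it upgrades the seat's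
census verdicts (`DISPROOF.md` §38, and the earlier shaped-partner censuses) from "shaped partners" to "ALL cubic partners";
it is NOT summit progress and produces no value above the `n = 14` record `57/64`.

**Setting** (as in `Negative.FibreL1Bound`).  `g` on `s + s + k` bits is a relabeled fibre family in sign form,
`(-1)^{g(y′ ‖ u ‖ w)} = (-1)^{y′·π(u)} (-1)^{G_u(w)}`, `σ = π⁻¹` two-sided.  A partner `f` is written (without loss — this is a
definition of `f′`, not a hypothesis on `f`) as `(-1)^{f(a ‖ b ‖ c)} = (-1)^{b·σ(a)} (-1)^{f′(a ‖ b ‖ c)}`; `f` is SHAPED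
(`f = b·σ(a) ⊕ F(a,c)`, the partner shape of `stub_fibreAverageRelabeled`) iff `f′` does not depend on `b`.

**Results.**
* `fsum_eq_fibreSigned`: `Σ_{x,y} (-1)^{f(x)+x·y+g(y)} = 2^s Σ_{a,c} W_{G_{σ(a)}}(c) · S(a,c)` with the FIBRE SUMS
  `S(a,c) = Σ_b (-1)^{f′(a‖b‖c)}`; and `|S(a,c)| ≤ 2^s − 2·dmin(a,c)` where `dmin(a,c) = min(#{b : f′ = 1}, #{b : f′ = 0})` is the
  distance of the fibre `b ↦ f′(a‖b‖c)` from the constants (`abs_fibreSum_le`); hence the DEFECT MASTER INEQUALITY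
  `Σ_{x,y} (-1)^{f(x)+x·y+g(y)} ≤ 2^s Σ_{a,c} |W_{G_{σ(a)}}(c)| (2^s − 2·dmin(a,c))` (`fsum_le_defect`), refining `far_fsum_le_l1`.
* `card_deriv_le_two_defect`: for every `β ∈ 𝔽₂^s` the derivative `x ↦ f′(x) ⊕ f′(x ⊕ (0‖β‖0))` has weight `≤ 2·D`,
  `D = Σ_{a,c} dmin(a,c)` the total defect (`defect`).
* `shape_of_defect_lt` (**the shape lemma**): if `f′` is CUBIC and `8·D < 2^{s+s+k}` then `f′(a‖b‖c) = f′(a‖0‖c)` for all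
  `a, b, c` — `f` is exactly shaped.  Proof: the `b`-derivatives of the cubic `f′` have degree `≤ 2` (`stub_derivDegree`) and
  weight `≤ 2D < 2^{n-2}`, so they vanish identically by the Reed–Muller bound (`stub_rmWeight`).
* `shape_of_forrelation_gt` (**bent slices**): if every slice coefficient satisfies `|W_{G_u}(c)| ≤ 2^m` on `k = m + m` bits
  (equality = all slices bent: the two-sided Maiorana–McFarland / `H(s, 2m; ·)` habitats with no apex) and `f′` is cubic, then
  `Φ(f,g) > 3/4` forces `f` to be exactly shaped.  With apexes one uses `fsum_le_defect` + `shape_of_defect_lt` directly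
  (the seat's `DISPROOF.md` §38.12 does the arithmetic: e.g. in `H(4,6;14)` with two apexes any cubic partner with
  `Φ > 57/64` is shaped when `σ` is quadratic, and `Φ ≤ 57/64` when `σ` has a cubic coordinate).

References: C. Carlet, Boolean Functions for Cryptography and Coding Theory (CUP 2021) Thm 7 p. 192 (Reed–Muller minimum
distance) and §6.1.15 (Maiorana–McFarland fibrations); F. J. MacWilliams, N. J. A. Sloane, The Theory of Error-Correcting Codes
(1977) Ch. 13 §3; S. Aaronson, A. Ambainis, Forrelation, SIAM J. Comput. 47 (2018) §1.1.1.  Everything below is proved;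
standard axioms only.
-/

set_option linter.dupNamespace false -- D-0017: single-problem summit ⇒ `QuantumAdvantage.QuantumAdvantage` by design

namespace Summit.QuantumAdvantage.QuantumAdvantage.Theorems.NearExactIsExact.Negative.ShapeLemma

open Finset
open Literature.Computability.QuantumComplexity
open Literature.Computability.QuantumComplexity.BuzetChailloux (bxor zeroVec)
open Literature.Computability.QuantumComplexity.DerivativeWalsh (W)
open Literature.Computability.QuantumComplexity.Simon (twist_mul_self)
open Summit.QuantumAdvantage.QuantumAdvantage.Theorems.CubicForrelation.NearExactIsExact
  (far_inner_sum mw_sqrt_two_pow stub_derivDegree stub_rmWeight)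
open Summit.QuantumAdvantage.QuantumAdvantage.Theorems.NearExactIsExact.Negative.FibreL1Bound (sum_const_twist_signOf)

variable {s k : ℕ}

/-! ### Fibre counts and the defect -/

/-! Throughout, for `f′ : 𝔽₂^{s+s+k} → 𝔽₂` and a fibre `(a, c)`:
`ct(a,c) = #{b : f′(a‖b‖c) = 1}` (written out as a `Finset.card`), `dmin(a,c) = min(ct, 2^s − ct)` = the Hamming distance
of the fibre `b ↦ f′(a‖b‖c)` from the constants, and the DEFECT `D = Σ_{a,c} dmin(a,c)` = the distance of `f′` from the
`b`-independent functions.  (They are written out in full in every statement, so that the file declares theorems only.) -/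

/-- `|𝔽₂ⁿ| = 2ⁿ`. [folklore] -/
theorem card_cube (n : ℕ) : (univ : Finset (Fin n → Bool)).card = 2 ^ n := by
  rw [card_univ, Fintype.card_fun, Fintype.card_bool, Fintype.card_fin]

/-- `#{b : f′ = 1} ≤ 2^s`. [folklore] -/
theorem ct_le (f' : (Fin (s + s + k) → Bool) → Bool) (a : Fin s → Bool) (c : Fin k → Bool) :
    (univ.filter fun b : Fin s → Bool => f' (Fin.append (Fin.append a b) c) = true).card ≤ 2 ^ s := by
  exact (card_filter_le _ _).trans (card_cube s).le

/-- `2·dmin ≤ 2^s`: a fibre is within half the cube of a constant. [folklore] -/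
theorem two_mul_dmin_le (f' : (Fin (s + s + k) → Bool) → Bool) (a : Fin s → Bool) (c : Fin k → Bool) :
    2 * min (univ.filter fun b : Fin s → Bool => f' (Fin.append (Fin.append a b) c) = true).card (2 ^ s - (univ.filter fun b : Fin s → Bool => f' (Fin.append (Fin.append a b) c) = true).card) ≤ 2 ^ s := by
  have := ct_le f' a c
  rcases min_choice ((univ.filter fun b : Fin s → Bool => f' (Fin.append (Fin.append a b) c) = true).card) (2 ^ s - (univ.filter fun b : Fin s → Bool => f' (Fin.append (Fin.append a b) c) = true).card) with h | h
  · rw [h]; omega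
  · rw [h]; omega

/-- The fibre sum counts: `Σ_b (-1)^{f′(a‖b‖c)} = 2^s − 2·#{b : f′ = 1}`. [folklore] -/
theorem fibreSum_eq (f' : (Fin (s + s + k) → Bool) → Bool) (a : Fin s → Bool) (c : Fin k → Bool) :
    ∑ b : Fin s → Bool, signOf (f' (Fin.append (Fin.append a b) c)) = (2 : ℝ) ^ s - 2 * ((univ.filter fun b : Fin s → Bool => f' (Fin.append (Fin.append a b) c) = true).card : ℝ) := by
  have e : ∀ b : Fin s → Bool, signOf (f' (Fin.append (Fin.append a b) c)) =
      1 - 2 * (if f' (Fin.append (Fin.append a b) c) = true then (1 : ℝ) else 0) := by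
    intro b
    cases f' (Fin.append (Fin.append a b) c) <;> norm_num [signOf]
  simp_rw [e]
  rw [sum_sub_distrib, ← mul_sum, sum_boole, sum_const, card_cube]
  simp

/-- `|Σ_b (-1)^{f′(a‖b‖c)}| ≤ 2^s − 2·dmin(a,c)` (in fact equality). [folklore] -/
theorem abs_fibreSum_le (f' : (Fin (s + s + k) → Bool) → Bool) (a : Fin s → Bool) (c : Fin k → Bool) :
    |∑ b : Fin s → Bool, signOf (f' (Fin.append (Fin.append a b) c))| ≤ (2 : ℝ) ^ s - 2 * ((min (univ.filter fun b : Fin s → Bool => f' (Fin.append (Fin.append a b) c) = true).card (2 ^ s - (univ.filter fun b : Fin s → Bool => f' (Fin.append (Fin.append a b) c) = true).card) : ℕ) : ℝ) := by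
  rw [fibreSum_eq]
  have hct := ct_le f' a c
  have hct' : ((univ.filter fun b : Fin s → Bool => f' (Fin.append (Fin.append a b) c) = true).card : ℝ) ≤ (2 : ℝ) ^ s := by exact_mod_cast hct
  rcases le_total (2 * (univ.filter fun b : Fin s → Bool => f' (Fin.append (Fin.append a b) c) = true).card) (2 ^ s) with h | h
  · have h' : 2 * ((univ.filter fun b : Fin s → Bool => f' (Fin.append (Fin.append a b) c) = true).card : ℝ) ≤ (2 : ℝ) ^ s := by exact_mod_cast h
    rw [abs_of_nonneg (by linarith)]
    have hm : ((min ((univ.filter fun b : Fin s → Bool => f' (Fin.append (Fin.append a b) c) = true).card) (2 ^ s - (univ.filter fun b : Fin s → Bool => f' (Fin.append (Fin.append a b) c) = true).card) : ℕ) : ℝ) ≤ ((univ.filter fun b : Fin s → Bool => f' (Fin.append (Fin.append a b) c) = true).card : ℝ) := by exact_mod_cast min_le_left _ _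
    linarith
  · have h' : (2 : ℝ) ^ s ≤ 2 * ((univ.filter fun b : Fin s → Bool => f' (Fin.append (Fin.append a b) c) = true).card : ℝ) := by exact_mod_cast h
    rw [abs_of_nonpos (by linarith)]
    have hm : ((min ((univ.filter fun b : Fin s → Bool => f' (Fin.append (Fin.append a b) c) = true).card) (2 ^ s - (univ.filter fun b : Fin s → Bool => f' (Fin.append (Fin.append a b) c) = true).card) : ℕ) : ℝ) ≤ ((2 ^ s - (univ.filter fun b : Fin s → Bool => f' (Fin.append (Fin.append a b) c) = true).card : ℕ) : ℝ) := by
      exact_mod_cast min_le_right _ _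
    have hsub : ((2 ^ s - (univ.filter fun b : Fin s → Bool => f' (Fin.append (Fin.append a b) c) = true).card : ℕ) : ℝ) = (2 : ℝ) ^ s - ((univ.filter fun b : Fin s → Bool => f' (Fin.append (Fin.append a b) c) = true).card : ℝ) := by
      rw [Nat.cast_sub hct]
      push_cast
      ring
    rw [hsub] at hm
    linarith

/-! ### The signed fibre identity and the defect master inequality -/

/-- **Signed fibre identity.** With `(-1)^{f} = (-1)^{b·σ(a)}(-1)^{f′}` and `g` in relabeled fibre sign form,
`Σ_{x,y} (-1)^{f(x)} (-1)^{x·y} (-1)^{g(y)} = 2^s Σ_a Σ_c W_{G_{σ(a)}}(c) · Σ_b (-1)^{f′(a‖b‖c)}`. [folklore] -/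
theorem fsum_eq_fibreSigned (f f' g : (Fin (s + s + k) → Bool) → Bool)
    (G : (Fin s → Bool) → (Fin k → Bool) → Bool) (π σ : (Fin s → Bool) → (Fin s → Bool))
    (hσπ : ∀ u, σ (π u) = u) (hπσ : ∀ a, π (σ a) = a)
    (hg : ∀ (y u : Fin s → Bool) (w : Fin k → Bool),
      signOf (g (Fin.append (Fin.append y u) w)) = twist y (π u) * signOf (G u w))
    (hf : ∀ (a b : Fin s → Bool) (c : Fin k → Bool),
      signOf (f (Fin.append (Fin.append a b) c)) = twist b (σ a) * signOf (f' (Fin.append (Fin.append a b) c))) :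
    ∑ x : Fin (s + s + k) → Bool, ∑ y : Fin (s + s + k) → Bool, signOf (f x) * twist x y * signOf (g y) =
      (2 : ℝ) ^ s * ∑ a : Fin s → Bool, ∑ c : Fin k → Bool,
        W (fun w => signOf (G (σ a) w)) c * ∑ b : Fin s → Bool, signOf (f' (Fin.append (Fin.append a b) c)) := by
  rw [sum_append (n₁ := s + s) (n₂ := k), sum_append (n₁ := s) (n₂ := s)]
  have e : ∀ (a b : Fin s → Bool) (c : Fin k → Bool),
      ∑ y : Fin (s + s + k) → Bool, signOf (f (Fin.append (Fin.append a b) c)) *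
          twist (Fin.append (Fin.append a b) c) y * signOf (g y) =
        (2 : ℝ) ^ s * (W (fun w => signOf (G (σ a) w)) c * signOf (f' (Fin.append (Fin.append a b) c))) := by
    intro a b c
    rw [far_inner_sum g G π σ hσπ hπσ hg, sum_const_twist_signOf, hf]
    have ht := twist_mul_self b (σ a)
    linear_combination ((2 : ℝ) ^ s * signOf (f' (Fin.append (Fin.append a b) c)) *
      W (fun w => signOf (G (σ a) w)) c) * ht
  simp_rw [e]
  rw [mul_sum]
  refine sum_congr rfl fun a _ => ?_
  rw [sum_comm, mul_sum]
  refine sum_congr rfl fun c _ => ?_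
  rw [mul_sum, mul_sum]

/-- **Defect master inequality.** Under the same hypotheses,
`Σ_{x,y} (-1)^{f(x)} (-1)^{x·y} (-1)^{g(y)} ≤ 2^s Σ_a Σ_c |W_{G_{σ(a)}}(c)| · (2^s − 2·dmin(a,c))`. [folklore] -/
theorem fsum_le_defect (f f' g : (Fin (s + s + k) → Bool) → Bool)
    (G : (Fin s → Bool) → (Fin k → Bool) → Bool) (π σ : (Fin s → Bool) → (Fin s → Bool))
    (hσπ : ∀ u, σ (π u) = u) (hπσ : ∀ a, π (σ a) = a)
    (hg : ∀ (y u : Fin s → Bool) (w : Fin k → Bool),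
      signOf (g (Fin.append (Fin.append y u) w)) = twist y (π u) * signOf (G u w))
    (hf : ∀ (a b : Fin s → Bool) (c : Fin k → Bool),
      signOf (f (Fin.append (Fin.append a b) c)) = twist b (σ a) * signOf (f' (Fin.append (Fin.append a b) c))) :
    ∑ x : Fin (s + s + k) → Bool, ∑ y : Fin (s + s + k) → Bool, signOf (f x) * twist x y * signOf (g y) ≤
      (2 : ℝ) ^ s * ∑ a : Fin s → Bool, ∑ c : Fin k → Bool,
        |W (fun w => signOf (G (σ a) w)) c| * ((2 : ℝ) ^ s - 2 * ((min (univ.filter fun b : Fin s → Bool => f' (Fin.append (Fin.append a b) c) = true).card (2 ^ s - (univ.filter fun b : Fin s → Bool => f' (Fin.append (Fin.append a b) c) = true).card) : ℕ) : ℝ)) := by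
  rw [fsum_eq_fibreSigned f f' g G π σ hσπ hπσ hg hf]
  refine mul_le_mul_of_nonneg_left (sum_le_sum fun a _ => sum_le_sum fun c _ => ?_) (by positivity)
  refine (le_abs_self _).trans ?_
  rw [abs_mul]
  exact mul_le_mul_of_nonneg_left (abs_fibreSum_le f' a c) (abs_nonneg _)

/-! ### Derivatives along the middle block have weight at most twice the defect -/

/-- The translation `0 ‖ β ‖ 0` moves only the middle block. [folklore] -/
theorem bxor_append3 (a b β : Fin s → Bool) (c : Fin k → Bool) :
    bxor (Fin.append (Fin.append a b) c) (Fin.append (Fin.append zeroVec β) zeroVec) =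
      Fin.append (Fin.append a (bxor b β)) c := by
  funext v
  induction v using Fin.addCases with
  | left i =>
      simp only [bxor, Fin.append_left]
      induction i using Fin.addCases with
      | left j => simp only [Fin.append_left, zeroVec, Bool.xor_false]
      | right j => simp only [Fin.append_right, bxor]
  | right j => simp only [bxor, Fin.append_right, zeroVec, Bool.xor_false]

/-- Translating the argument by `β` does not change a count over `𝔽₂^s`. [folklore] -/
theorem card_filter_bxor (Q : (Fin s → Bool) → Prop) [DecidablePred Q] (β : Fin s → Bool) :
    (univ.filter fun b : Fin s → Bool => Q (bxor b β)).card = (univ.filter Q).card := by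
  have hinv : Function.Involutive (fun b : Fin s → Bool => bxor b β) := by
    intro b
    funext i
    simp [bxor]
  rw [card_filter, card_filter]
  exact Equiv.sum_comp (hinv.toPerm _) (fun b => if Q b then 1 else 0)

/-- Sums over `𝔽₂^{n₁+n₂}` split along `Fin.append` (any additive commutative monoid). [folklore] -/
theorem sum_append' {M : Type*} [AddCommMonoid M] {n₁ n₂ : ℕ} (F : (Fin (n₁ + n₂) → Bool) → M) :
    ∑ x, F x = ∑ x₁ : Fin n₁ → Bool, ∑ x₂ : Fin n₂ → Bool, F (Fin.append x₁ x₂) := by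
  rw [← (Fin.appendEquiv n₁ n₂).sum_comp, Fintype.sum_prod_type]
  rfl

/-- In one fibre, `#{b : f′(a‖b‖c) ≠ f′(a‖b⊕β‖c)} ≤ 2·dmin(a,c)`. [folklore] -/
theorem card_fibreDeriv_le (f' : (Fin (s + s + k) → Bool) → Bool) (a β : Fin s → Bool) (c : Fin k → Bool) :
    (univ.filter fun b : Fin s → Bool =>
        (f' (Fin.append (Fin.append a b) c) ^^ f' (Fin.append (Fin.append a (bxor b β)) c)) = true).card ≤
      2 * min (univ.filter fun b : Fin s → Bool => f' (Fin.append (Fin.append a b) c) = true).card (2 ^ s - (univ.filter fun b : Fin s → Bool => f' (Fin.append (Fin.append a b) c) = true).card) := by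
  set P : (Fin s → Bool) → Bool := fun b => f' (Fin.append (Fin.append a b) c) with hP
  have hct : (univ.filter fun b : Fin s → Bool => P b = true).card = (univ.filter fun b : Fin s → Bool => f' (Fin.append (Fin.append a b) c) = true).card := rfl
  have hcf : (univ.filter fun b : Fin s → Bool => P b = false).card = 2 ^ s - (univ.filter fun b : Fin s → Bool => f' (Fin.append (Fin.append a b) c) = true).card := by
    have h := card_filter_add_card_filter_not (s := (univ : Finset (Fin s → Bool))) (fun b => P b = true)
    rw [card_cube] at h
    simp only [Bool.not_eq_true] at h
    rw [← hct]
    omega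
  have h1 : (univ.filter fun b : Fin s → Bool => (P b ^^ P (bxor b β)) = true).card ≤ 2 * (univ.filter fun b : Fin s → Bool => f' (Fin.append (Fin.append a b) c) = true).card := by
    calc (univ.filter fun b : Fin s → Bool => (P b ^^ P (bxor b β)) = true).card
        ≤ ((univ.filter fun b : Fin s → Bool => P b = true) ∪
            (univ.filter fun b : Fin s → Bool => P (bxor b β) = true)).card := by
          refine card_le_card fun b hb => ?_
          simp only [mem_filter, mem_union, mem_univ, true_and] at hb ⊢
          revert hb
          cases P b <;> cases P (bxor b β) <;> simp
      _ ≤ (univ.filter fun b : Fin s → Bool => P b = true).card +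
            (univ.filter fun b : Fin s → Bool => P (bxor b β) = true).card := card_union_le _ _
      _ = 2 * (univ.filter fun b : Fin s → Bool => f' (Fin.append (Fin.append a b) c) = true).card := by rw [card_filter_bxor (fun b => P b = true) β, hct]; ring
  have h2 : (univ.filter fun b : Fin s → Bool => (P b ^^ P (bxor b β)) = true).card ≤ 2 * (2 ^ s - (univ.filter fun b : Fin s → Bool => f' (Fin.append (Fin.append a b) c) = true).card) := by
    calc (univ.filter fun b : Fin s → Bool => (P b ^^ P (bxor b β)) = true).card
        ≤ ((univ.filter fun b : Fin s → Bool => P b = false) ∪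
            (univ.filter fun b : Fin s → Bool => P (bxor b β) = false)).card := by
          refine card_le_card fun b hb => ?_
          simp only [mem_filter, mem_union, mem_univ, true_and] at hb ⊢
          revert hb
          cases P b <;> cases P (bxor b β) <;> simp
      _ ≤ (univ.filter fun b : Fin s → Bool => P b = false).card +
            (univ.filter fun b : Fin s → Bool => P (bxor b β) = false).card := card_union_le _ _
      _ = 2 * (2 ^ s - (univ.filter fun b : Fin s → Bool => f' (Fin.append (Fin.append a b) c) = true).card) := by rw [card_filter_bxor (fun b => P b = false) β, hcf]; ring
  rcases min_choice ((univ.filter fun b : Fin s → Bool => f' (Fin.append (Fin.append a b) c) = true).card) (2 ^ s - (univ.filter fun b : Fin s → Bool => f' (Fin.append (Fin.append a b) c) = true).card) with h | h <;> rw [h]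
  · exact h1
  · exact h2

/-- **Derivative weight bound.** For every `β`, the derivative `x ↦ f′(x) ⊕ f′(x ⊕ (0‖β‖0))` has weight at most `2·D`.
[folklore] -/
theorem card_deriv_le_two_defect (f' : (Fin (s + s + k) → Bool) → Bool) (β : Fin s → Bool) :
    (univ.filter fun x : Fin (s + s + k) → Bool =>
        (f' x ^^ f' (bxor x (Fin.append (Fin.append zeroVec β) zeroVec))) = true).card ≤ 2 * (∑ a : Fin s → Bool, ∑ c : Fin k → Bool, min (univ.filter fun b : Fin s → Bool => f' (Fin.append (Fin.append a b) c) = true).card (2 ^ s - (univ.filter fun b : Fin s → Bool => f' (Fin.append (Fin.append a b) c) = true).card)) := by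
  rw [card_filter, sum_append' (n₁ := s + s) (n₂ := k), sum_append' (n₁ := s) (n₂ := s)]
  simp_rw [bxor_append3]
  rw [mul_sum]
  refine sum_le_sum fun a _ => ?_
  rw [sum_comm, mul_sum]
  refine sum_le_sum fun c _ => ?_
  rw [← card_filter]
  exact card_fibreDeriv_le f' a β c

/-! ### The shape lemma -/

/-- **Shape lemma.** If `f′` is cubic and its total defect satisfies `8·D < 2^{s+s+k}`, then `f′` does not depend on the
middle block: `f′(a‖b‖c) = f′(a‖0‖c)`.  (So a partner `f` with `(-1)^f = (-1)^{b·σ(a)}(-1)^{f′}` is EXACTLY of the shape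
`b·σ(a) ⊕ F(a,c)`.)  Proof: each `b`-derivative of `f′` has degree `≤ 2` and weight `≤ 2D < 2^{n−2}`, hence vanishes by the
Reed–Muller bound. [cite: Carlet2020, Thm 7 p. 192] -/
theorem shape_of_defect_lt (f' : (Fin (s + s + k) → Bool) → Bool) (hf' : IsDegLeFun 3 f')
    (hD : 8 * (∑ a : Fin s → Bool, ∑ c : Fin k → Bool, min (univ.filter fun b : Fin s → Bool => f' (Fin.append (Fin.append a b) c) = true).card (2 ^ s - (univ.filter fun b : Fin s → Bool => f' (Fin.append (Fin.append a b) c) = true).card)) < 2 ^ (s + s + k)) (a b : Fin s → Bool) (c : Fin k → Bool) :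
    f' (Fin.append (Fin.append a b) c) = f' (Fin.append (Fin.append a zeroVec) c) := by
  by_contra hne
  set t : Fin (s + s + k) → Bool := Fin.append (Fin.append zeroVec b) zeroVec with ht
  have he2 : IsDegLeFun 2 (fun x => f' x ^^ f' (bxor x t)) := stub_derivDegree (s + s + k) 2 f' t hf'
  have hex : ∃ x, (f' x ^^ f' (bxor x t)) = true := by
    refine ⟨Fin.append (Fin.append a b) c, ?_⟩
    rw [ht, bxor_append3]
    have hbb : bxor b b = zeroVec := by funext i; simp [bxor, zeroVec]
    rw [hbb]
    revert hne
    cases f' (Fin.append (Fin.append a b) c) <;> cases f' (Fin.append (Fin.append a zeroVec) c) <;> simp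
  have hw := stub_rmWeight stub_derivDegree (s + s + k) 2 (fun x => f' x ^^ f' (bxor x t)) he2 hex
  have hcard := card_deriv_le_two_defect f' b
  rw [← ht] at hcard
  have : 2 ^ (s + s + k) ≤ 8 * (∑ a : Fin s → Bool, ∑ c : Fin k → Bool, min (univ.filter fun b : Fin s → Bool => f' (Fin.append (Fin.append a b) c) = true).card (2 ^ s - (univ.filter fun b : Fin s → Bool => f' (Fin.append (Fin.append a b) c) = true).card)) :=
    hw.trans (by calc 2 ^ 2 * (univ.filter fun x => (f' x ^^ f' (bxor x t)) = true).card
        ≤ 2 ^ 2 * (2 * (∑ a : Fin s → Bool, ∑ c : Fin k → Bool, min (univ.filter fun b : Fin s → Bool => f' (Fin.append (Fin.append a b) c) = true).card (2 ^ s - (univ.filter fun b : Fin s → Bool => f' (Fin.append (Fin.append a b) c) = true).card))) := Nat.mul_le_mul_left _ hcard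
      _ = 8 * (∑ a : Fin s → Bool, ∑ c : Fin k → Bool, min (univ.filter fun b : Fin s → Bool => f' (Fin.append (Fin.append a b) c) = true).card (2 ^ s - (univ.filter fun b : Fin s → Bool => f' (Fin.append (Fin.append a b) c) = true).card)) := by ring)
  omega

/-- **Shape lemma, bent-slice form.** Let `g` be a relabeled fibre family on `s + s + (m + m)` bits all of whose slice
coefficients satisfy `|W_{G_u}(c)| ≤ 2^m` (all slices bent gives equality), and write the partner as
`(-1)^{f} = (-1)^{b·σ(a)} (-1)^{f′}` with `f′` CUBIC (automatic when `f` is cubic and `σ` quadratic).  If `Φ(f,g) > 3/4` then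
`f′(a‖b‖c) = f′(a‖0‖c)` for all `a, b, c`: every such partner is exactly shaped.  (`Φ ≤ 1 − 2D/2^n` by `fsum_le_defect`,
so `Φ > 3/4` gives `8D < 2^n` and `shape_of_defect_lt` applies.) [folklore] -/
theorem shape_of_forrelation_gt {s m : ℕ} (f f' g : (Fin (s + s + (m + m)) → Bool) → Bool)
    (G : (Fin s → Bool) → (Fin (m + m) → Bool) → Bool) (π σ : (Fin s → Bool) → (Fin s → Bool))
    (hσπ : ∀ u, σ (π u) = u) (hπσ : ∀ a, π (σ a) = a)
    (hg : ∀ (y u : Fin s → Bool) (w : Fin (m + m) → Bool),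
      signOf (g (Fin.append (Fin.append y u) w)) = twist y (π u) * signOf (G u w))
    (hf : ∀ (a b : Fin s → Bool) (c : Fin (m + m) → Bool),
      signOf (f (Fin.append (Fin.append a b) c)) = twist b (σ a) * signOf (f' (Fin.append (Fin.append a b) c)))
    (hf' : IsDegLeFun 3 f') (hK : ∀ (u : Fin s → Bool) (c : Fin (m + m) → Bool), |W (fun w => signOf (G u w)) c| ≤ (2 : ℝ) ^ m)
    (hΦ : 3 / 4 < forrelation f g) (a b : Fin s → Bool) (c : Fin (m + m) → Bool) :
    f' (Fin.append (Fin.append a b) c) = f' (Fin.append (Fin.append a zeroVec) c) := by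
  refine shape_of_defect_lt f' hf' ?_ a b c
  -- the defect bound in real form
  have hS := fsum_le_defect f f' g G π σ hσπ hπσ hg hf
  have hnn : ∀ (a : Fin s → Bool) (c : Fin (m + m) → Bool), (0 : ℝ) ≤ (2 : ℝ) ^ s - 2 * ((min (univ.filter fun b : Fin s → Bool => f' (Fin.append (Fin.append a b) c) = true).card (2 ^ s - (univ.filter fun b : Fin s → Bool => f' (Fin.append (Fin.append a b) c) = true).card) : ℕ) : ℝ) := by
    intro a c
    have h := two_mul_dmin_le f' a c
    have h' : 2 * ((min (univ.filter fun b : Fin s → Bool => f' (Fin.append (Fin.append a b) c) = true).card (2 ^ s - (univ.filter fun b : Fin s → Bool => f' (Fin.append (Fin.append a b) c) = true).card) : ℕ) : ℝ) ≤ (2 : ℝ) ^ s := by exact_mod_cast h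
    linarith
  have hK' : ∑ a : Fin s → Bool, ∑ c : Fin (m + m) → Bool,
        |W (fun w => signOf (G (σ a) w)) c| * ((2 : ℝ) ^ s - 2 * ((min (univ.filter fun b : Fin s → Bool => f' (Fin.append (Fin.append a b) c) = true).card (2 ^ s - (univ.filter fun b : Fin s → Bool => f' (Fin.append (Fin.append a b) c) = true).card) : ℕ) : ℝ)) ≤
      ∑ a : Fin s → Bool, ∑ c : Fin (m + m) → Bool, (2 : ℝ) ^ m * ((2 : ℝ) ^ s - 2 * ((min (univ.filter fun b : Fin s → Bool => f' (Fin.append (Fin.append a b) c) = true).card (2 ^ s - (univ.filter fun b : Fin s → Bool => f' (Fin.append (Fin.append a b) c) = true).card) : ℕ) : ℝ)) :=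
    sum_le_sum fun a _ => sum_le_sum fun c _ => mul_le_mul_of_nonneg_right (hK _ _) (hnn a c)
  have hsplit : ∑ a : Fin s → Bool, ∑ c : Fin (m + m) → Bool, (2 : ℝ) ^ m * ((2 : ℝ) ^ s - 2 * ((min (univ.filter fun b : Fin s → Bool => f' (Fin.append (Fin.append a b) c) = true).card (2 ^ s - (univ.filter fun b : Fin s → Bool => f' (Fin.append (Fin.append a b) c) = true).card) : ℕ) : ℝ)) =
      (2 : ℝ) ^ m * ((2 : ℝ) ^ s * (2 : ℝ) ^ (m + m) * (2 : ℝ) ^ s - 2 * (((∑ a : Fin s → Bool, ∑ c : Fin (m + m) → Bool, min (univ.filter fun b : Fin s → Bool => f' (Fin.append (Fin.append a b) c) = true).card (2 ^ s - (univ.filter fun b : Fin s → Bool => f' (Fin.append (Fin.append a b) c) = true).card)) : ℕ) : ℝ)) := by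
    push_cast
    simp only [mul_sub, sum_sub_distrib, sum_const, card_cube, nsmul_eq_mul, ← mul_sum]
    push_cast
    ring
  have h2 : ∑ x : Fin (s + s + (m + m)) → Bool, ∑ y : Fin (s + s + (m + m)) → Bool,
      signOf (f x) * twist x y * signOf (g y) ≤
      (2 : ℝ) ^ s * ((2 : ℝ) ^ m * ((2 : ℝ) ^ s * (2 : ℝ) ^ (m + m) * (2 : ℝ) ^ s - 2 * (((∑ a : Fin s → Bool, ∑ c : Fin (m + m) → Bool, min (univ.filter fun b : Fin s → Bool => f' (Fin.append (Fin.append a b) c) = true).card (2 ^ s - (univ.filter fun b : Fin s → Bool => f' (Fin.append (Fin.append a b) c) = true).card)) : ℕ) : ℝ))) := by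
    refine hS.trans ?_
    rw [← hsplit]
    exact mul_le_mul_of_nonneg_left hK' (by positivity)
  -- the forrelation hypothesis in real form
  unfold forrelation at hΦ
  rw [sqrt_two_pow_three_mul_add (s + s) (m + m), mw_sqrt_two_pow s, mw_sqrt_two_pow m] at hΦ
  have hc : (0 : ℝ) < (2 : ℝ) ^ s * (2 : ℝ) ^ (2 * s) * ((2 : ℝ) ^ m * (2 : ℝ) ^ (2 * m)) := by positivity
  have h1 := mul_lt_mul_of_pos_left hΦ hc
  rw [mul_inv_cancel_left₀ hc.ne'] at h1
  rw [pow_add] at h2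
  rw [two_mul, pow_add, two_mul, pow_add] at h1
  have hX : (0 : ℝ) < (2 : ℝ) ^ s := by positivity
  have hY : (0 : ℝ) < (2 : ℝ) ^ m := by positivity
  have hXY : (0 : ℝ) < (2 : ℝ) ^ s * (2 : ℝ) ^ m := mul_pos hX hY
  have h3 : (2 : ℝ) ^ s * (2 : ℝ) ^ m * (8 * (((∑ a : Fin s → Bool, ∑ c : Fin (m + m) → Bool, min (univ.filter fun b : Fin s → Bool => f' (Fin.append (Fin.append a b) c) = true).card (2 ^ s - (univ.filter fun b : Fin s → Bool => f' (Fin.append (Fin.append a b) c) = true).card)) : ℕ) : ℝ)) <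
      (2 : ℝ) ^ s * (2 : ℝ) ^ m * ((2 : ℝ) ^ s * (2 : ℝ) ^ s * ((2 : ℝ) ^ m * (2 : ℝ) ^ m)) := by
    nlinarith [h1, h2, hXY]
  have h4 : 8 * (((∑ a : Fin s → Bool, ∑ c : Fin (m + m) → Bool, min (univ.filter fun b : Fin s → Bool => f' (Fin.append (Fin.append a b) c) = true).card (2 ^ s - (univ.filter fun b : Fin s → Bool => f' (Fin.append (Fin.append a b) c) = true).card)) : ℕ) : ℝ) < (2 : ℝ) ^ s * (2 : ℝ) ^ s * ((2 : ℝ) ^ m * (2 : ℝ) ^ m) :=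
    lt_of_mul_lt_mul_left h3 hXY.le
  have h5 : 8 * (((∑ a : Fin s → Bool, ∑ c : Fin (m + m) → Bool, min (univ.filter fun b : Fin s → Bool => f' (Fin.append (Fin.append a b) c) = true).card (2 ^ s - (univ.filter fun b : Fin s → Bool => f' (Fin.append (Fin.append a b) c) = true).card)) : ℕ) : ℝ) < (2 : ℝ) ^ (s + s + (m + m)) := by
    rw [pow_add, pow_add, pow_add]
    exact h4
  exact_mod_cast h5

end Summit.QuantumAdvantage.QuantumAdvantage.Theorems.NearExactIsExact.Negative.ShapeLemma
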